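import Summits.BirchSwinnertonDyer.BirchSwinnertonDyer.Theorems.KatoDescentPotSupersingularWildFineSelmerSupersingularCMAnchor
import Literature.NumberTheory.EllipticCurves.SerreOpenImageDeterminantProofs
import Literature.NumberTheory.EllipticCurves.FineSelmerMuRoadCartanImageThree
import HarnessLib

/-!
# K9 `WildCoatesSujathaResidue` (stmt-19942) — the `p = 3` Cartan μ-road (b) with the involution binders DISCHARGED by
# complex conjugation: statement (A) at `(W, 3)` from the mod-3 image predicate and ONE classical `μ = 0` hypothesis on the
# maximal real subfield of `ℚ(W[3])` (cell `bsd-potss`, seat `bsd-potss-k9-c4` g18; `--supports` 19942 / 19197; closes nothing)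

HONEST FRAMING. Route-free THEOREMS ONLY (no definition, no named fact, no `sorry`). Seat `conjA-anchor` g11 landed the road
`CoatesSujatha2005.fineSelmerDual_moduleFinite_of_hasSplitCartanNormalizerModPImage_three` /
`…_of_hasModPImageEqNonsplitCartanNormalizer_three{,'}` (p620850): statement (A) at `3` from the image predicate, an element
`τ ∈ Γ_ℚ` acting on `W[3]` as an involution `≠ 1, −1` (three binders `hτ2 hτ1 hτm`), `μ = 0` for the cyclotomic `ℤ_3`-extension of
the fixed field of `τ|_{ℚ(W[3])}`, Ferrero–Washington and Coates–Sujatha Thm. 3.4 (named facts). §1 of this file proves that a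
COMPLEX CONJUGATION `c ∈ Γ_ℚ` (`IsComplexConjugation (Rat.castHom ℝ) c`, which exists: `exists_isComplexConjugation`) is such a `τ`
on `W[ℓ]` for EVERY elliptic `W/ℚ` and every odd prime `ℓ`: `c² = 1`, and `c ≠ ±1` on `W[ℓ]` because `det ρ̄_{W,ℓ}(c) = χ̄_ℓ(c) = −1`
(Weil pairing, tree theorem `det_frame_galoisRepTorsion_eq`; Serre 1972 §5.2 (iv)) while `det(±1) = 1 ≠ −1` for `ℓ ≠ 2` — i.e.
`W(ℝ)[ℓ]` is a line. §2 are the K9 doors: (A) at `(W,3)` from {image predicate, `μ = 0` for every cyclotomic `ℤ_3`-extension of the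
fixed field of `c|_{ℚ(W[3])}` — the maximal real subfield of `ℚ(W[3])` for the embedding under which `c` is conjugation, i.e. `ℚ(P)`
for a REAL `3`-torsion point `P` (degree `4` on `3Ns` rows, `8` on `3Nn` rows)}, modulo the named facts; §3 composes them with k9-c4 g5's
`WildFineSelmerSupersingularCMAnchor.missingUpperBoundAt_wild_of_conjA` (Kato's A161-fine reading + GZK + modularity, named facts)
into the U₀ statement `MissingUpperBoundAt W 3` of the node `WildUpperNonsurjTower` (item 19189; parent 19197) at the row `W`.
Nothing is asserted about any curve; (A), Conjecture A and BSD are proved for no curve here.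

References: [Serre1972, §2.2, §5.2 (iii)–(iv)]; [SilvermanAEC2009, III.8]; [CoatesSujatha2005, Thm. 3.4]; [Washington1997, §7.5, §13.1].
-/

set_option linter.dupNamespace false
set_option autoImplicit false

noncomputable section

open scoped NumberField
open Field IntermediateField WeierstrassCurve Literature.NumberTheory.EllipticCurves
  Literature.NumberTheory.GaloisRepresentations Literature.NumberTheory.SerreUniformity
  Literature.NumberTheory.IwasawaTheory

namespace Summit.BirchSwinnertonDyer.BirchSwinnertonDyer.Theorems.CartanMuRoadRealDoors

/-! ### §1 Complex conjugation on `W[ℓ]`, `ℓ` odd: an involution `≠ 1, −1` -/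

section Torsion

variable (W : WeierstrassCurve ℚ) [W.IsElliptic] (ℓ : ℕ) [Fact ℓ.Prime]

/-- Two matrices with the same action on all vectors `e T` (`e` an additive bijection onto `𝔽_ℓ²`) are equal. [folklore] -/
private theorem matrix_eq_of_forall_mulVec {A : Type*} [AddCommGroup A] (e : A ≃+ (Fin 2 → ZMod ℓ))
    {M N : Matrix (Fin 2) (Fin 2) (ZMod ℓ)} (h : ∀ T : A, M.mulVec (e T) = N.mulVec (e T)) : M = N :=
  Matrix.toLin'.injective (LinearMap.ext fun v => by
    rw [Matrix.toLin'_apply, Matrix.toLin'_apply, ← e.apply_symm_apply v, h])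

/-- `(1 : 𝔽_ℓ) ≠ −1` for an odd prime `ℓ`. [folklore] -/
private theorem one_ne_neg_one (hℓ : ℓ ≠ 2) : (1 : ZMod ℓ) ≠ -1 := by
  intro h
  have h2 : ((2 : ℕ) : ZMod ℓ) = 0 := by
    rw [Nat.cast_ofNat]
    linear_combination h
  have hdvd := (ZMod.natCast_eq_zero_iff 2 ℓ).mp h2
  have hp : ℓ.Prime := Fact.out
  exact hℓ ((Nat.prime_dvd_prime_iff_eq hp Nat.prime_two).mp hdvd)

/-- **`det ρ̄_{W,ℓ}(c) = −1` for a complex conjugation `c`**, in any frame `(e, Φ)` of `W[ℓ]`: `det ρ̄ = χ̄_ℓ` (Weil pairing) and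
`χ̄_ℓ(c) = −1`. [cite: Serre1972, §5.2 (iii)–(iv)] [cite: SilvermanAEC2009, III.8] -/
theorem det_frame_galoisRepTorsion_of_isComplexConjugation (e : geomTorsion W ℓ ≃+ (Fin 2 → ZMod ℓ))
    (Φ : Multiplicative (AddAut (geomTorsion W ℓ)) → GL (Fin 2) (ZMod ℓ))
    (he : ∀ (g : Multiplicative (AddAut (geomTorsion W ℓ))) (x : geomTorsion W ℓ),
      e (Multiplicative.toAdd g x) = ((Φ g : GL (Fin 2) (ZMod ℓ)) : Matrix (Fin 2) (Fin 2) (ZMod ℓ)).mulVec (e x))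
    {c : absoluteGaloisGroup ℚ} (hc : IsComplexConjugation (Rat.castHom ℝ) c) :
    Matrix.det ((Φ (galoisRepTorsion W ℓ c) : GL (Fin 2) (ZMod ℓ)) : Matrix (Fin 2) (Fin 2) (ZMod ℓ)) = -1 := by
  haveI : NeZero (ℓ : ℚ) := ⟨Nat.cast_ne_zero.mpr (Fact.out : ℓ.Prime).ne_zero⟩
  haveI : NeZero ℓ := ⟨(Fact.out : ℓ.Prime).ne_zero⟩
  rw [det_frame_galoisRepTorsion_eq W ℓ e Φ he c, modPCyclotomicCharacterZMod_eq_modNCyclotomicCharacter]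
  exact modNCyclotomicCharacter_of_isComplexConjugation hc

variable {W ℓ}

omit [W.IsElliptic] [Fact ℓ.Prime] in
/-- `ρ̄_{W,ℓ}(σ) = 1` when `σ` fixes `W[ℓ]` pointwise (local copy of the tree's `galoisRepTorsion_eq_one_iff`, to keep the import
closure light). [folklore] -/
private theorem galoisRepTorsion_eq_one_of_forall {σ : absoluteGaloisGroup ℚ} (h : ∀ P : geomTorsion W ℓ, σ • P = P) :
    galoisRepTorsion W ℓ σ = 1 := by
  refine Multiplicative.toAdd.injective (AddEquiv.ext fun P ↦ ?_)
  rw [galoisRepTorsion_apply]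
  exact h P

omit [W.IsElliptic] [Fact ℓ.Prime] in
/-- **A complex conjugation acts on `W[ℓ]` as an involution**: `c • (c • T) = T` (`c² = 1`). [folklore] -/
theorem smul_smul_of_isComplexConjugation {c : absoluteGaloisGroup ℚ} (hc : IsComplexConjugation (Rat.castHom ℝ) c)
    (T : geomTorsion W ℓ) : c • (c • T) = T := by
  rw [← mul_smul, ← pow_two, hc.sq_eq_one, one_smul]

/-- **A complex conjugation does not fix `W[ℓ]` pointwise** (`ℓ` an odd prime): otherwise `ρ̄(c) = 1` would have determinant
`1 ≠ −1 = χ̄_ℓ(c)`. [cite: Serre1972, §5.2 (iv)] -/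
theorem exists_smul_ne_of_isComplexConjugation (hℓ : ℓ ≠ 2) {c : absoluteGaloisGroup ℚ}
    (hc : IsComplexConjugation (Rat.castHom ℝ) c) : ∃ T : geomTorsion W ℓ, c • T ≠ T := by
  by_contra h
  push Not at h
  obtain ⟨e, Φ, he, -, -, -, -⟩ := exists_frame_galoisRepTorsion_rat W ℓ
  have h1 : galoisRepTorsion W ℓ c = 1 := galoisRepTorsion_eq_one_of_forall h
  have hdet := det_frame_galoisRepTorsion_of_isComplexConjugation W ℓ e Φ he hc
  rw [h1, map_one, Units.val_one, Matrix.det_one] at hdet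
  exact one_ne_neg_one ℓ hℓ hdet

/-- **A complex conjugation does not act as `−1` on `W[ℓ]`** (`ℓ` an odd prime): `ρ̄(c) = −1` would have determinant
`(−1)² = 1 ≠ −1 = χ̄_ℓ(c)`. [cite: Serre1972, §5.2 (iv)] -/
theorem exists_smul_ne_neg_of_isComplexConjugation (hℓ : ℓ ≠ 2) {c : absoluteGaloisGroup ℚ}
    (hc : IsComplexConjugation (Rat.castHom ℝ) c) : ∃ T : geomTorsion W ℓ, c • T ≠ -T := by
  by_contra h
  push Not at h
  obtain ⟨e, Φ, he, -, -, -, -⟩ := exists_frame_galoisRepTorsion_rat W ℓ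
  have hM : ((Φ (galoisRepTorsion W ℓ c) : GL (Fin 2) (ZMod ℓ)) : Matrix (Fin 2) (Fin 2) (ZMod ℓ)) = -1 := by
    refine matrix_eq_of_forall_mulVec ℓ e fun T => ?_
    rw [← he, Matrix.neg_mulVec, Matrix.one_mulVec, ← map_neg, ← h T]
    rfl
  have hdet := det_frame_galoisRepTorsion_of_isComplexConjugation W ℓ e Φ he hc
  rw [hM, Matrix.det_neg, Matrix.det_one, mul_one, Fintype.card_fin] at hdet
  norm_num at hdet
  exact one_ne_neg_one ℓ hℓ hdet

end Torsion

/-! ### §2 The K9 doors: statement (A) at `(W, 3)` from the image predicate and `μ = 0` on the maximal real subfield of `ℚ(W[3])` -/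

section Doors

variable (W : WeierstrassCurve ℚ) [W.IsElliptic]

/-- **(A) at `(W,3)` on a `3Ns` row from ONE classical `μ`-hypothesis** (modulo Coates–Sujatha Thm. 3.4 `hCS` and Ferrero–Washington
`hFW`, named facts): `HasSplitCartanNormalizerModPImage W 3`, a complex conjugation `c`, and `μ = 0` for every cyclotomic
`ℤ_3`-extension of the fixed field of `c|_{ℚ(W[3])}` (the maximal real subfield `ℚ(W[3])⁺ = ℚ(P)`, `P` a real `3`-torsion point;
degree `4` when the image is all of `C_s⁺(3)`) give: for every cyclotomic `ℤ_3`-extension `κ` of `ℚ` the dual fine Selmer group of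
`W` over `ℚ_cyc` is finitely generated over `ℤ_3`. CONDITIONAL; (A) is asserted for no curve.
[cite: CoatesSujatha2005, Thm. 3.4 (§3)] [cite: Serre1972, §2.2, §5.2 (iv)] [cite: Washington1997, §7.5, §13.1] -/
theorem conjA_three_of_hasSplitCartanNormalizerModPImage_of_realMu
    (hCS : CoatesSujatha2005.thm34_fineSelmerDual_moduleFinite_of_classicalMuVanishes_divisionField)
    (hFW : ferreroWashington1979_classicalMuVanishes)
    (himg : HasSplitCartanNormalizerModPImage W 3) {c : absoluteGaloisGroup ℚ}
    (hc : IsComplexConjugation (Rat.castHom ℝ) c)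
    (hμ : ∀ κE : ZpExtension ↥(fixedField (Subgroup.zpowers (absRestrictNormalHom (W.divisionField 3) c))) 3,
      κE.IsCyclotomic → ClassicalMuVanishes κE)
    (κ : ZpExtension ℚ 3) (hκ : κ.IsCyclotomic) :
    ∃ (γ : absoluteGaloisGroup ℚ) (D : W.FineSelmerDualData κ γ),
      Module.Finite ℤ_[3] (RestrictScalars ℤ_[3] (IwasawaAlgebra 3) D.X) :=
  haveI : Fact (Nat.Prime 3) := ⟨Nat.prime_three⟩
  CoatesSujatha2005.fineSelmerDual_moduleFinite_of_hasSplitCartanNormalizerModPImage_three hCS hFW W himg c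
    (smul_smul_of_isComplexConjugation hc) (exists_smul_ne_of_isComplexConjugation (by decide) hc)
    (exists_smul_ne_neg_of_isComplexConjugation (by decide) hc) hμ κ hκ

/-- **(A) at `(W,3)` on a `3Nn` row from ONE classical `μ`-hypothesis, paying Iwasawa's growth theorem** (`hI`; modulo `hCS`,
`hFW`): `HasModPImageEqNonsplitCartanNormalizer W 3`, a complex conjugation `c`, and `μ = 0` for every cyclotomic
`ℤ_3`-extension of the fixed field of `c|_{ℚ(W[3])}` (`= ℚ(P)`, `P` a real `3`-torsion point, degree `8`). CONDITIONAL.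
[cite: CoatesSujatha2005, Thm. 3.4 (§3)] [cite: Serre1972, §2.2, §5.2 (iv)] [cite: Washington1997, §13.1] -/
theorem conjA_three_of_hasModPImageEqNonsplitCartanNormalizer_of_realMu'
    (hCS : CoatesSujatha2005.thm34_fineSelmerDual_moduleFinite_of_classicalMuVanishes_divisionField)
    (hI : iwasawa1959_classNumberPExp_growth) (hFW : ferreroWashington1979_classicalMuVanishes)
    (himg : HasModPImageEqNonsplitCartanNormalizer W 3) {c : absoluteGaloisGroup ℚ}
    (hc : IsComplexConjugation (Rat.castHom ℝ) c)
    (hμ : ∀ κE : ZpExtension ↥(fixedField (Subgroup.zpowers (absRestrictNormalHom (W.divisionField 3) c))) 3,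
      κE.IsCyclotomic → ClassicalMuVanishes κE)
    (κ : ZpExtension ℚ 3) (hκ : κ.IsCyclotomic) :
    ∃ (γ : absoluteGaloisGroup ℚ) (D : W.FineSelmerDualData κ γ),
      Module.Finite ℤ_[3] (RestrictScalars ℤ_[3] (IwasawaAlgebra 3) D.X) :=
  haveI : Fact (Nat.Prime 3) := ⟨Nat.prime_three⟩
  CoatesSujatha2005.fineSelmerDual_moduleFinite_of_hasModPImageEqNonsplitCartanNormalizer_three' hCS hI hFW W himg c
    (smul_smul_of_isComplexConjugation hc) (exists_smul_ne_of_isComplexConjugation (by decide) hc)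
    (exists_smul_ne_neg_of_isComplexConjugation (by decide) hc) hμ κ hκ

/-- **(A) at `(W,3)` on a `3Nn` row, growth-fact-free, from TWO classical `μ`-hypotheses** (modulo `hCS`, `hFW`):
`HasModPImageEqNonsplitCartanNormalizer W 3`, a complex conjugation `c`, `μ = 0` for every cyclotomic `ℤ_3`-extension of the
fixed field of `c|_{ℚ(W[3])}` (`ℚ(P)`, degree `8`) AND of the fixed field of `⟨c, τ₋⟩|_{ℚ(W[3])}` for every `τ₋ ∈ Γ_ℚ` acting as
`−1` on `W[3]` (`ℚ(x(P))`, degree `4`; such `τ₋` exist since the image is all of `C_ns⁺(3) ∋ −1`, and the field does not depend on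
the choice). CONDITIONAL. [cite: CoatesSujatha2005, Thm. 3.4 (§3)] [cite: Serre1972, §2.2, §5.2 (iv)] [cite: Washington1997, §7.5, §13.1] -/
theorem conjA_three_of_hasModPImageEqNonsplitCartanNormalizer_of_realMu
    (hCS : CoatesSujatha2005.thm34_fineSelmerDual_moduleFinite_of_classicalMuVanishes_divisionField)
    (hFW : ferreroWashington1979_classicalMuVanishes)
    (himg : HasModPImageEqNonsplitCartanNormalizer W 3) {c : absoluteGaloisGroup ℚ}
    (hc : IsComplexConjugation (Rat.castHom ℝ) c)
    (hμ : ∀ κE : ZpExtension ↥(fixedField (Subgroup.zpowers (absRestrictNormalHom (W.divisionField 3) c))) 3,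
      κE.IsCyclotomic → ClassicalMuVanishes κE)
    (hμ' : ∀ τm : absoluteGaloisGroup ℚ, (∀ T : W.geomTorsion (3 : ℕ), τm • T = -T) →
      ∀ κE : ZpExtension ↥(fixedField (Subgroup.zpowers (absRestrictNormalHom (W.divisionField 3) c) ⊔
        Subgroup.zpowers (absRestrictNormalHom (W.divisionField 3) τm))) 3, κE.IsCyclotomic → ClassicalMuVanishes κE)
    (κ : ZpExtension ℚ 3) (hκ : κ.IsCyclotomic) :
    ∃ (γ : absoluteGaloisGroup ℚ) (D : W.FineSelmerDualData κ γ),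
      Module.Finite ℤ_[3] (RestrictScalars ℤ_[3] (IwasawaAlgebra 3) D.X) := by
  haveI : Fact (Nat.Prime 3) := ⟨Nat.prime_three⟩
  -- an element acting as `−1`: the image is all of `C_ns⁺(ε) ∋ −1`
  obtain ⟨e, ε, hε, -, hsurj⟩ := id himg
  have hneg : (-1 : Matrix (Fin 2) (Fin 2) (ZMod 3)) ∈ nonsplitCartanNormalizer ε := by
    refine ⟨-1, 0, ?_, Or.inl ?_⟩
    · simp
    · ext i j; fin_cases i <;> fin_cases j <;> simp
  obtain ⟨τm, hτm⟩ := hsurj (-1) hneg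
  have hm : ∀ T : W.geomTorsion (3 : ℕ), τm • T = -T := fun T =>
    e.injective (by rw [hτm T, Matrix.neg_mulVec, Matrix.one_mulVec, map_neg])
  exact CoatesSujatha2005.fineSelmerDual_moduleFinite_of_hasModPImageEqNonsplitCartanNormalizer_three hCS hFW W himg c τm
    (smul_smul_of_isComplexConjugation hc) (exists_smul_ne_of_isComplexConjugation (by decide) hc)
    (exists_smul_ne_neg_of_isComplexConjugation (by decide) hc) hm hμ (hμ' τm hm) κ hκ

end Doors

/-! ### §3 The U₀ statement `MissingUpperBoundAt W 3` (node 19189 / item 19197 at the row `W`) through the doors -/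

section Upper

open Literature.NumberTheory.EllipticCurves.Rank1Residual.Typed Summit.BirchSwinnertonDyer.Rank1Residual.Additive

variable (W : WeierstrassCurve ℚ) [W.IsElliptic] [W.IsGloballyMinimal]

/-- **U₀ at a `3Ns` residue row from ONE classical `μ`-hypothesis**: `ord₃ #Ш(W) ≤ ord₃ #Ш_an(W)` (`MissingUpperBoundAt W 3`) for a
rank-`0` O6 row with `W[3]` irreducible and `3Ns` image, from Kato's fine-Selmer reading A161-fine (`hKatoA`), GZK (`hGZK`),
modularity (`hmod`), Coates–Sujatha Thm. 3.4 (`hCS`), Ferrero–Washington (`hFW`) — all named facts — and `μ = 0` for the cyclotomic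
`ℤ_3`-extension of the maximal real subfield of `ℚ(W[3])` (`hμ`). CONDITIONAL; nothing booked; BSD for no curve.
[cite: Kato2004Asterisque, Thm. 14.5 (3) (p. 236), Thm. 12.5 (3) (p. 222)] [cite: CoatesSujatha2005, Thm. 3.4 (§3)] [cite: Serre1972, §5.2 (iv)] -/
theorem missingUpperBoundAt_three_of_hasSplitCartanNormalizerModPImage_of_realMu
    (hKatoA : Kato2004.rankZero_padicValNat_sha_add_padicValNat_tamagawa_le_of_additive_potGood_of_irreducible_of_fineSelmerDual_fg)
    (hGZK : rank_eq_analyticRank_of_analyticRank_le_one) (hmod : hasEntireLFunction_rat)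
    (hCS : CoatesSujatha2005.thm34_fineSelmerDual_moduleFinite_of_classicalMuVanishes_divisionField)
    (hFW : ferreroWashington1979_classicalMuVanishes) [Fact (3 : ℕ).Prime]
    (hr : W.analyticRank = 0) (hO : ClassO6 W 3) (hirr : W.HasIrreducibleModPGaloisRep 3)
    (himg : HasSplitCartanNormalizerModPImage W 3) {c : absoluteGaloisGroup ℚ} (hc : IsComplexConjugation (Rat.castHom ℝ) c)
    (hμ : ∀ κE : ZpExtension ↥(fixedField (Subgroup.zpowers (absRestrictNormalHom (W.divisionField 3) c))) 3,
      κE.IsCyclotomic → ClassicalMuVanishes κE) :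
    MissingUpperBoundAt W 3 :=
  WildFineSelmerSupersingularCMAnchor.missingUpperBoundAt_wild_of_conjA hKatoA hGZK hmod W hr hO hirr
    (conjA_three_of_hasSplitCartanNormalizerModPImage_of_realMu W hCS hFW himg hc hμ)

/-- **U₀ at a `3Nn` residue row from ONE classical `μ`-hypothesis, paying Iwasawa's growth theorem** (`hI`): as above with
`HasModPImageEqNonsplitCartanNormalizer W 3`. CONDITIONAL; nothing booked; BSD for no curve.
[cite: Kato2004Asterisque, Thm. 14.5 (3) (p. 236)] [cite: CoatesSujatha2005, Thm. 3.4 (§3)] [cite: Washington1997, §13.1] -/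
theorem missingUpperBoundAt_three_of_hasModPImageEqNonsplitCartanNormalizer_of_realMu'
    (hKatoA : Kato2004.rankZero_padicValNat_sha_add_padicValNat_tamagawa_le_of_additive_potGood_of_irreducible_of_fineSelmerDual_fg)
    (hGZK : rank_eq_analyticRank_of_analyticRank_le_one) (hmod : hasEntireLFunction_rat)
    (hCS : CoatesSujatha2005.thm34_fineSelmerDual_moduleFinite_of_classicalMuVanishes_divisionField)
    (hI : iwasawa1959_classNumberPExp_growth) (hFW : ferreroWashington1979_classicalMuVanishes) [Fact (3 : ℕ).Prime]
    (hr : W.analyticRank = 0) (hO : ClassO6 W 3) (hirr : W.HasIrreducibleModPGaloisRep 3)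
    (himg : HasModPImageEqNonsplitCartanNormalizer W 3) {c : absoluteGaloisGroup ℚ}
    (hc : IsComplexConjugation (Rat.castHom ℝ) c)
    (hμ : ∀ κE : ZpExtension ↥(fixedField (Subgroup.zpowers (absRestrictNormalHom (W.divisionField 3) c))) 3,
      κE.IsCyclotomic → ClassicalMuVanishes κE) :
    MissingUpperBoundAt W 3 :=
  WildFineSelmerSupersingularCMAnchor.missingUpperBoundAt_wild_of_conjA hKatoA hGZK hmod W hr hO hirr
    (conjA_three_of_hasModPImageEqNonsplitCartanNormalizer_of_realMu' W hCS hI hFW himg hc hμ)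

/-- **U₀ at a `3Nn` residue row, growth-fact-free, from TWO classical `μ`-hypotheses** (`ℚ(P)` and `ℚ(x(P))` of the real
`3`-torsion point `P`). CONDITIONAL; nothing booked; BSD for no curve.
[cite: Kato2004Asterisque, Thm. 14.5 (3) (p. 236)] [cite: CoatesSujatha2005, Thm. 3.4 (§3)] [cite: Washington1997, §7.5, §13.1] -/
theorem missingUpperBoundAt_three_of_hasModPImageEqNonsplitCartanNormalizer_of_realMu
    (hKatoA : Kato2004.rankZero_padicValNat_sha_add_padicValNat_tamagawa_le_of_additive_potGood_of_irreducible_of_fineSelmerDual_fg)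
    (hGZK : rank_eq_analyticRank_of_analyticRank_le_one) (hmod : hasEntireLFunction_rat)
    (hCS : CoatesSujatha2005.thm34_fineSelmerDual_moduleFinite_of_classicalMuVanishes_divisionField)
    (hFW : ferreroWashington1979_classicalMuVanishes) [Fact (3 : ℕ).Prime]
    (hr : W.analyticRank = 0) (hO : ClassO6 W 3) (hirr : W.HasIrreducibleModPGaloisRep 3)
    (himg : HasModPImageEqNonsplitCartanNormalizer W 3) {c : absoluteGaloisGroup ℚ}
    (hc : IsComplexConjugation (Rat.castHom ℝ) c)
    (hμ : ∀ κE : ZpExtension ↥(fixedField (Subgroup.zpowers (absRestrictNormalHom (W.divisionField 3) c))) 3,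
      κE.IsCyclotomic → ClassicalMuVanishes κE)
    (hμ' : ∀ τm : absoluteGaloisGroup ℚ, (∀ T : W.geomTorsion (3 : ℕ), τm • T = -T) →
      ∀ κE : ZpExtension ↥(fixedField (Subgroup.zpowers (absRestrictNormalHom (W.divisionField 3) c) ⊔
        Subgroup.zpowers (absRestrictNormalHom (W.divisionField 3) τm))) 3, κE.IsCyclotomic → ClassicalMuVanishes κE) :
    MissingUpperBoundAt W 3 :=
  WildFineSelmerSupersingularCMAnchor.missingUpperBoundAt_wild_of_conjA hKatoA hGZK hmod W hr hO hirr
    (conjA_three_of_hasModPImageEqNonsplitCartanNormalizer_of_realMu W hCS hFW himg hc hμ hμ')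

end Upper

end Summit.BirchSwinnertonDyer.BirchSwinnertonDyer.Theorems.CartanMuRoadRealDoors

end
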